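import Mathlib.NumberTheory.Height.NumberField
import Mathlib.NumberTheory.NumberField.InfinitePlace.Embeddings
import Mathlib.RingTheory.DedekindDomain.AdicValuation
import Mathlib.GroupTheory.OrderOfElement
import HarnessLib

/-!
# Kronecker's theorem in Weil-height form: height zero ⟺ zero or a root of unity

E. Bombieri, W. Gubler, *Heights in Diophantine Geometry*, Cambridge (2006), Theorem 1.5.9
(Kronecker's theorem) [cite: BombieriGubler2006, Thm 1.5.9]: for an algebraic number `ξ ≠ 0`, the
absolute logarithmic Weil height vanishes, `h(ξ) = 0`, if and only if `ξ` is a root of unity.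

Mathlib has the Weil height on a number field `K` (`Height.mulHeight₁`, `Height.logHeight₁`, with
`NumberField.mulHeight₁_eq` = the familiar product over the places of `K`), the Northcott property, and
Kronecker's theorem in its CLASSICAL form `NumberField.Embeddings.pow_eq_one_of_norm_le_one` (a nonzero
algebraic integer all of whose complex conjugates lie in the closed unit disc is a root of unity), but
not the height form. This file supplies it, for elements of a number field `K` (the height used is
Mathlib's height relative to `K`; vanishing is insensitive to the normalisation):

* `infinitePlace_le_one_of_mulHeight₁_eq_one`, `finitePlace_le_one_of_mulHeight₁_eq_one`: if
  `H(x) = 1` then `|x|_v ≤ 1` at every place `v` of `K`;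
* `isIntegral_of_mulHeight₁_eq_one`: hence `x` is an algebraic integer;
* `mulHeight₁_eq_one_iff`, `logHeight₁_eq_zero_iff` (**Kronecker**): `H(x) = 1 ⟺ h(x) = 0 ⟺ x = 0 ∨ x`
  is a root of unity; `logHeight₁_eq_zero_iff_isOfFinOrder`, `logHeight₁_pos_iff`;
* small consequences used when comparing roots of different orders of the same element (the
  "freshness" of `p`-th roots in covering arguments): `logHeight₁_eq_div_of_pow_eq`
  (`z ^ n = a ⟹ h(z) = h(a)/n`), `isOfFinOrder_of_pow_eq_pow` (`z ^ p = z ^ q`, `p ≠ q`, `z ≠ 0 ⟹ z`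
  torsion), `mul_logHeight₁_eq_of_pow_eq` (`z ^ p = a`, `z ^ q = b ⟹ q·h(a) = p·h(b)`).

Everything is proved (Mathlib only); no named facts. Written as classical support for the
`ℙ¹`-menu route to [GenEll] Thm 2.1 (ii) ⇒ (i) (support item GenEllTwo of route IUTThetaPilot); it is
independent of anything disputed.
-/

namespace Literature.NumberTheory.DiophantineGeometry

open NumberField Height

variable {K : Type*} [Field K] [NumberField K]

/-! ### Elementary real-number bookkeeping -/

/-- In a finite product of real numbers all `≥ 1`, each factor is at most the product. [folklore] -/
private theorem single_le_prod_of_one_le {ι : Type*} {s : Finset ι} {f : ι → ℝ} (hf : ∀ j ∈ s, 1 ≤ f j)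
    {i : ι} (hi : i ∈ s) : f i ≤ ∏ j ∈ s, f j := by
  classical
  rw [← Finset.mul_prod_erase s f hi]
  have h1 : 1 ≤ ∏ j ∈ s.erase i, f j :=
    Finset.one_le_prod fun j hj => hf j (Finset.mem_of_mem_erase hj)
  have h0 : 0 ≤ f i := zero_le_one.trans (hf i hi)
  calc f i = f i * 1 := (mul_one _).symm
    _ ≤ f i * ∏ j ∈ s.erase i, f j := mul_le_mul_of_nonneg_left h1 h0

/-! ### From `H(x) = 1` to `|x|_v ≤ 1` at every place -/

/-- The archimedean part `∏_v max(|x|_v, 1)^{n_v}` of the height of `x` is `≥ 1`. [folklore] -/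
private theorem one_le_prod_infinitePlace_max (x : K) :
    1 ≤ ∏ v : InfinitePlace K, max (v x) 1 ^ v.mult :=
  Finset.one_le_prod fun _ _ => one_le_pow₀ (le_max_right _ _)

/-- The nonarchimedean part `∏_w max(|x|_w, 1)` of the height of `x` is `≥ 1`. [folklore] -/
private theorem one_le_finprod_finitePlace_max (x : K) :
    1 ≤ ∏ᶠ w : FinitePlace K, max (w x) 1 := by
  refine finprod_induction (fun r : ℝ => 1 ≤ r) le_rfl (fun a b ha hb => ?_)
    fun w => le_max_right _ _
  calc (1 : ℝ) = 1 * 1 := (mul_one _).symm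
    _ ≤ a * b := mul_le_mul ha hb zero_le_one (zero_le_one.trans ha)

/-- The function `w ↦ max(|x|_w, 1)` on the finite places of `K` has finite multiplicative support
(for `x ≠ 0`). [folklore] -/
private theorem hasFiniteMulSupport_finitePlace_max {x : K} (hx : x ≠ 0) :
    Function.HasFiniteMulSupport fun w : FinitePlace K => max (w x) 1 :=
  (FinitePlace.hasFiniteMulSupport hx).max Function.hasFiniteMulSupport_one

/-- If `H(x) = 1` then `|x|_v ≤ 1` at every infinite place `v` of `K`.
[cite: BombieriGubler2006, Thm 1.5.9] -/
theorem infinitePlace_le_one_of_mulHeight₁_eq_one {x : K} (h : mulHeight₁ x = 1)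
    (v : InfinitePlace K) : v x ≤ 1 := by
  have hx : mulHeight₁ x = (∏ v : InfinitePlace K, max (v x) 1 ^ v.mult) *
      ∏ᶠ w : FinitePlace K, max (w x) 1 := NumberField.mulHeight₁_eq x
  have hA : (∏ v : InfinitePlace K, max (v x) 1 ^ v.mult) ≤ 1 := by
    have hB := one_le_finprod_finitePlace_max x
    have hA0 : 0 ≤ ∏ v : InfinitePlace K, max (v x) 1 ^ v.mult :=
      zero_le_one.trans (one_le_prod_infinitePlace_max x)
    nlinarith [hx, h]
  have h1 : max (v x) 1 ≤ max (v x) 1 ^ v.mult :=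
    le_self_pow₀ (le_max_right _ _) InfinitePlace.mult_ne_zero
  have h2 : max (v x) 1 ^ v.mult ≤ ∏ v : InfinitePlace K, max (v x) 1 ^ v.mult :=
    single_le_prod_of_one_le (f := fun w : InfinitePlace K => max (w x) 1 ^ w.mult)
      (fun w _ => one_le_pow₀ (le_max_right _ _)) (Finset.mem_univ v)
  exact (le_max_left _ _).trans (h1.trans (h2.trans hA))

/-- If `H(x) = 1` and `x ≠ 0` then `|x|_w ≤ 1` at every finite place `w` of `K`.
[cite: BombieriGubler2006, Thm 1.5.9] -/
theorem finitePlace_le_one_of_mulHeight₁_eq_one {x : K} (hx : x ≠ 0) (h : mulHeight₁ x = 1)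
    (w : FinitePlace K) : w x ≤ 1 := by
  classical
  have hxe : mulHeight₁ x = (∏ v : InfinitePlace K, max (v x) 1 ^ v.mult) *
      ∏ᶠ w : FinitePlace K, max (w x) 1 := NumberField.mulHeight₁_eq x
  have hB : (∏ᶠ w : FinitePlace K, max (w x) 1) ≤ 1 := by
    have hA := one_le_prod_infinitePlace_max x
    have hB0 : 0 ≤ ∏ᶠ w : FinitePlace K, max (w x) 1 :=
      zero_le_one.trans (one_le_finprod_finitePlace_max x)
    nlinarith [hxe, h]
  have hfin := hasFiniteMulSupport_finitePlace_max hx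
  -- write the finite product as a product over a finite set containing `w`
  set s : Finset (FinitePlace K) := insert w hfin.toFinset with hs
  have hsub : hfin.toFinset ⊆ s := Finset.subset_insert _ _
  have hprod : (∏ᶠ w : FinitePlace K, max (w x) 1) = ∏ w' ∈ s, max (w' x) 1 :=
    finprod_eq_prod_of_mulSupport_toFinset_subset _ hfin hsub
  have hw : max (w x) 1 ≤ ∏ w' ∈ s, max (w' x) 1 :=
    single_le_prod_of_one_le (f := fun w' : FinitePlace K => max (w' x) 1)
      (fun w' _ => le_max_right _ _) (Finset.mem_insert_self _ _)
  rw [← hprod] at hw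
  exact (le_max_left _ _).trans (hw.trans hB)

/-- If `H(x) = 1` then `x` is an algebraic integer: `|x|_w ≤ 1` at all finite places means that all
`𝔭`-adic valuations of `x` are `≥ 0`. [cite: BombieriGubler2006, Thm 1.5.9] -/
theorem isIntegral_of_mulHeight₁_eq_one {x : K} (h : mulHeight₁ x = 1) : IsIntegral ℤ x := by
  by_cases hx : x = 0
  · rw [hx]; exact isIntegral_zero
  have hval : ∀ v : IsDedekindDomain.HeightOneSpectrum (𝓞 K), v.valuation K x ≤ 1 := by
    intro v
    have h1 : (FinitePlace.mk v) x ≤ 1 := finitePlace_le_one_of_mulHeight₁_eq_one hx h _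
    rw [FinitePlace.mk_apply, FinitePlace.norm_embedding'] at h1
    have h2 : WithZeroMulInt.toNNReal (HeightOneSpectrum.absNorm_ne_zero v) (v.valuation K x) ≤ 1 := by
      exact_mod_cast h1
    exact (WithZeroMulInt.toNNReal_le_one_iff (HeightOneSpectrum.one_lt_absNorm_nnreal v)).1 h2
  obtain ⟨y, hy⟩ := IsDedekindDomain.HeightOneSpectrum.mem_integers_of_valuation_le_one K x hval
  rw [← hy]
  exact y.isIntegral_coe

/-! ### Kronecker's theorem -/

/-- **Kronecker's theorem, multiplicative height**: for `x` in a number field `K`, `H(x) = 1` if and only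
if `x = 0` or `x` is a root of unity. [cite: BombieriGubler2006, Thm 1.5.9] -/
theorem mulHeight₁_eq_one_iff (x : K) :
    mulHeight₁ x = 1 ↔ x = 0 ∨ ∃ n : ℕ, 0 < n ∧ x ^ n = 1 := by
  constructor
  · intro h
    by_cases hx : x = 0
    · exact Or.inl hx
    right
    have hxi : IsIntegral ℤ x := isIntegral_of_mulHeight₁_eq_one h
    have hφ : ∀ φ : K →+* ℂ, ‖φ x‖ ≤ 1 := fun φ => by
      rw [← InfinitePlace.apply]
      exact infinitePlace_le_one_of_mulHeight₁_eq_one h _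
    obtain ⟨n, hn, hxn⟩ := NumberField.Embeddings.pow_eq_one_of_norm_le_one K ℂ hx hxi hφ
    exact ⟨n, hn, hxn⟩
  · rintro (rfl | ⟨n, hn, hxn⟩)
    · exact mulHeight₁_zero
    · have h := mulHeight₁_pow x n
      rw [hxn, mulHeight₁_one] at h
      exact (pow_eq_one_iff_of_nonneg (mulHeight₁_nonneg x) hn.ne').1 h.symm

/-- **Kronecker's theorem, logarithmic height**: for `x` in a number field `K`, `h(x) = 0` if and only if
`x = 0` or `x` is a root of unity. [cite: BombieriGubler2006, Thm 1.5.9] -/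
theorem logHeight₁_eq_zero_iff (x : K) :
    logHeight₁ x = 0 ↔ x = 0 ∨ ∃ n : ℕ, 0 < n ∧ x ^ n = 1 := by
  rw [← mulHeight₁_eq_one_iff, logHeight₁_eq_log_mulHeight₁]
  constructor
  · exact fun h => Real.eq_one_of_pos_of_log_eq_zero (mulHeight₁_pos x) h
  · intro h
    rw [h, Real.log_one]

/-- Kronecker's theorem for nonzero `x`, phrased with `IsOfFinOrder`: `h(x) = 0 ⟺ x` has finite order in
`Kˣ`, i.e. is a root of unity. [cite: BombieriGubler2006, Thm 1.5.9] -/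
theorem logHeight₁_eq_zero_iff_isOfFinOrder {x : K} (hx : x ≠ 0) :
    logHeight₁ x = 0 ↔ IsOfFinOrder x := by
  rw [logHeight₁_eq_zero_iff, isOfFinOrder_iff_pow_eq_one, or_iff_right hx]

/-- The height of a nonzero non-torsion element of a number field is POSITIVE (contrapositive of
Kronecker's theorem; heights are `≥ 0`). [cite: BombieriGubler2006, Thm 1.5.9] -/
theorem logHeight₁_pos_iff (x : K) :
    0 < logHeight₁ x ↔ x ≠ 0 ∧ ¬ IsOfFinOrder x := by
  rw [(zero_le_logHeight₁ x).lt_iff_ne, ne_comm, Ne, logHeight₁_eq_zero_iff,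
    isOfFinOrder_iff_pow_eq_one, not_or]

/-- A root of unity has height zero. [cite: BombieriGubler2006, Thm 1.5.9] -/
theorem logHeight₁_eq_zero_of_isOfFinOrder {x : K} (h : IsOfFinOrder x) : logHeight₁ x = 0 :=
  (logHeight₁_eq_zero_iff x).2 (Or.inr (isOfFinOrder_iff_pow_eq_one.1 h))

/-! ### Consequences for roots: `z ^ n = a` -/

/-- If `z ^ n = a` with `n ≠ 0` then `h(z) = h(a) / n` (`h(α^λ) = |λ|·h(α)` for `λ = 1/n`).
[cite: BombieriGubler2006, Lemma 1.5.18] -/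
theorem logHeight₁_eq_div_of_pow_eq {z a : K} {n : ℕ} (hn : n ≠ 0) (h : z ^ n = a) :
    logHeight₁ z = logHeight₁ a / n := by
  rw [← h, logHeight₁_pow, mul_div_cancel_left₀ _ (Nat.cast_ne_zero.2 hn)]

/-- If `z ^ p = z ^ q` for natural numbers `p ≠ q` and `z ≠ 0` (in any group with zero), then `z` has
finite order — the elementary algebraic shadow of `p·h(z) = q·h(z) ⟹ h(z) = 0 ⟹ z` torsion (Lemma 1.5.18
with Kronecker's theorem). [cite: BombieriGubler2006, Thm 1.5.9] -/
theorem isOfFinOrder_of_pow_eq_pow {G : Type*} [GroupWithZero G] {z : G} (hz : z ≠ 0) {p q : ℕ}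
    (hpq : p ≠ q) (h : z ^ p = z ^ q) : IsOfFinOrder z := by
  rw [isOfFinOrder_iff_pow_eq_one]
  wlog hlt : p < q generalizing p q
  · exact this hpq.symm h.symm (lt_of_le_of_ne (not_lt.1 hlt) hpq.symm)
  refine ⟨q - p, Nat.sub_pos_of_lt hlt, ?_⟩
  have hzp : z ^ p ≠ 0 := pow_ne_zero _ hz
  have : z ^ p * z ^ (q - p) = z ^ p * 1 := by
    rw [← pow_add, Nat.add_sub_cancel' hlt.le, mul_one, ← h]
  exact mul_left_cancel₀ hzp this

/-- Distinct-order roots of a non-torsion element are distinct: if `z ^ p = a = z ^ q` with `p ≠ q`,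
`a ≠ 0`, then `a` is a root of unity. (So for `a` of positive height its `p`-th roots, `p` varying, are
pairwise distinct — the "fresh roots" input of covering arguments; height form: Lemma 1.5.18 +
Kronecker.) [cite: BombieriGubler2006, Thm 1.5.9] -/
theorem isOfFinOrder_of_pow_eq_of_pow_eq {G : Type*} [GroupWithZero G] {z a : G} (ha : a ≠ 0)
    {p q : ℕ} (hpq : p ≠ q) (hp : z ^ p = a) (hq : z ^ q = a) : IsOfFinOrder a := by
  have hz : z ≠ 0 := by
    rintro rfl
    rcases Nat.eq_zero_or_pos p with rfl | hp0
    · rcases Nat.eq_zero_or_pos q with rfl | hq0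
      · exact hpq rfl
      · exact ha (by rw [← hq, zero_pow hq0.ne'])
    · exact ha (by rw [← hp, zero_pow hp0.ne'])
  have hzfin : IsOfFinOrder z := isOfFinOrder_of_pow_eq_pow hz hpq (hp.trans hq.symm)
  rw [← hp]
  exact hzfin.pow

/-- Height bookkeeping for a common root: if `z ^ p = a` and `z ^ q = b` then `q · h(a) = p · h(b)`
(both sides equal `p q · h(z)`); with Kronecker's theorem this pins down, for `a, b` of positive height,
at most one ratio `p : q`. [cite: BombieriGubler2006, Lemma 1.5.18] -/
theorem mul_logHeight₁_eq_of_pow_eq {z a b : K} {p q : ℕ} (hp : z ^ p = a) (hq : z ^ q = b) :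
    (q : ℝ) * logHeight₁ a = p * logHeight₁ b := by
  rw [← hp, ← hq, logHeight₁_pow, logHeight₁_pow]
  ring

end Literature.NumberTheory.DiophantineGeometry
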